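import Literature.AlgebraicGeometry.Motives.MixedHodgeStructureCatGrW
import Literature.AlgebraicGeometry.Motives.MixedHodgeStructureCatDualFunctor
import Literature.AlgebraicGeometry.Motives.MixedHodgeStructureDualGr
import Literature.AlgebraicGeometry.Motives.HodgeStructureAbelianTypeDual
import HarnessLib

/-!
# `Gr^W` commutes with duality, functorially: `Gr^W_k(X^∨) ≅ (Gr^W_{-k} X)^∨` in `HodgeStructureCat k`

Layer `Literature/AlgebraicGeometry/Motives` (lane `lit-hodgefound`), the categorical dictionary of mixed Hodge structures, part V
(the functor `gr k : MixedHodgeStructureCat ⥤ HodgeStructureCat k`, `Motives/MixedHodgeStructureCatGrW`; the duality functor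
`dualFunctor : FinSubcategoryᵒᵖ ⥤ FinSubcategory`, `X ↦ X^∨`, `f ↦ f^∨ = transposeHom f`, `Motives/MixedHodgeStructureCatDualFunctor`).
For the dual mixed Hodge structure (`W_r(X^∨) = (W_{-r-1} X)^⊥`, `F^p(X^∨) = (F^{1-p} X)^⊥`; Fujiki (1.6.2) a), Deligne 1.1.6–1.1.7,
Cattani–El Zein–Griffiths–Lê §3.2.2.7) the graded pieces are `Gr^W_r(X^∨) = (W_{-r-1})^⊥ ∕ (W_{-r})^⊥ ≅ (W_{-r} ∕ W_{-r-1})^∨ = (Gr^W_{-r} X)^∨`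
— El Zein, *Mixed Hodge structures*, §II.0.2: for the dual filtration on `H = Hom(K, K')` with `K'` trivially filtered, «`Gr^W_r H ≃ Hom(Gr^W_{-r} K, K')`».
The tree proves this UNBUNDLED (`Motives/MixedHodgeStructureDualGr`): `dualGrMap : Gr^W_r(H^∨) →ₗ (Gr^W_{-r} H)^∨`, `[φ] ↦ ([w] ↦ φ w)`, is a
bijective morphism of Hodge structures `dualGrHom : H^∨.gr r ⟶ ((H.gr (-r)).dual).cast _`.  A companion in `MixedHodgeStructureCat` at the level of
weight subquotients is `dualGrWIso : (W_{[k,k]} X)^∨ ≅ (gr (-k) ⋙ ofPure (-k)).obj (X^∨)` (`Motives/MixedHodgeStructureCatDualWeightSubquotients`).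
This file gives the statement in the PURE category `HodgeStructureCat k` and makes it FUNCTORIAL:

* §1 **`grDualIso k X : (gr k).obj (of X^∨) ≅ grDualObj k X`**, where `grDualObj k X = HodgeStructureCat.of (((X.str.gr (-k)).dual).cast (neg_neg k))`
  is the dual of the pure Hodge structure `Gr^W_{-k} X` (weight `-(-k)` transported to `k`); `[φ] ↦ ([w] ↦ φ w)`; bijective, inverse by strictness;
* §2 NATURALITY: for `f : X ⟶ Y`, **`(gr k).map (transposeHom f) ≫ (grDualIso k X).hom = (grDualIso k Y).hom ≫ grDualMapHom k f`**, where
  `grDualMapHom k f : (Gr^W_{-k} Y)^∨ ⟶ (Gr^W_{-k} X)^∨` is the transpose of `Gr^W_{-k}(f)` (on classes: `⟨Gr_k(f^∨)[φ], [w]⟩ = φ(f w) = ⟨[φ], Gr_{-k}(f)[w]⟩`);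
  conjugation and inverse forms;
* §3 the functor `grDualFunctor k : FinSubcategoryᵒᵖ ⥤ HodgeStructureCat k`, `X ↦ (Gr^W_{-k} X)^∨`, and the natural isomorphism
  **`grDualNatIso k : dualFunctor ⋙ ι ⋙ gr k ≅ grDualFunctor k`** — "`Gr^W_k ∘ (−)^∨ = ((−)^∨) ∘ Gr^W_{-k}`".

Everything is PROVED; no named fact, no instance, no notation.  As in the tree's dual ∕ tensor files, the `Prop`-class hypothesis `[HodgeTensorFacts]`
(discharged by `hodgeTensorFacts_holds`) is carried to form duals of pure Hodge structures, and finite-dimensionality (`[Module.Finite ℚ X]`) to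
form `X^∨`.  (The Hodge-number form `h^{p,q}(Gr^W_r X^∨) = h^{p,q}((Gr^W_{-r} X)^∨)` is the tree's `gr_dual_hodgeNumber`; `hodgeNumber_gr_obj_dual`
restates it on the objects of this file.)

Sources, verbatim.  F. El Zein, *Mixed Hodge structures*, Trans. AMS 275 (1983) [Elzein1983], §II.0.1–II.0.2 (dual filtrations on `Hom(K, K')`;
«`Gr^W_r H ≃ Hom(Gr^W_{-r} K, K')`»; quoted through the tree's `Motives/MixedHodgeStructureDualGr`).  A. Fujiki, *Duality of mixed Hodge structures
of algebraic varieties*, Publ. RIMS 16 (1980) [Fujiki1980], (1.6.2) a) (the dual MHS).  P. Deligne, *Théorie de Hodge II* [DeligneHodgeII1971],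
1.1.6–1.1.7 (dual filtrations), 1.1.11 (induced filtrations on `Gr`), Thm. 2.3.5 (iii) (`Gr^W_n` is a functor).  E. Cattani et al. (eds.), *Hodge Theory*
(2014) [CattaniElZeinGriffithsLe2014], §3.2.2.7 (p. 163: «In particular, the dual `H^*` of a mixed Hodge structure `H` is an MHS»), Thm. 3.2.18
(strictness; a bijective morphism is an isomorphism).  Linear algebra (`LinearMap.dualMap`, `NatIso.ofComponents`) is Mathlib's [folklore].

## Main results

* §1 `grDualObj`, **`grDualHom`** (`_toLinearMap`, `_toLinearMap_mk_mk`), **`grDualHom_bijective`**, `isIso_grDualHom`, **`grDualIso`** (`_hom`,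
  `_inv_toLinearMap_hom_toLinearMap`, `_hom_toLinearMap_inv_toLinearMap`), `hodgeNumber_gr_obj_dual`.
* §2 `grDualMapHom` (`_toLinearMap`, `_id`, `_comp`), `grDualHom_grMap_transposeHom_mk_mk`, **`gr_map_transposeHom_comp_grDualHom`**,
  `gr_map_transposeHom_comp_grDualIso_hom`, `gr_map_transposeHom_eq_conj`, `grDualIso_inv_comp_gr_map_transposeHom`.
* §3 `grDualFunctor` (`_obj`, `_map_toLinearMap`), **`grDualNatIso`** (`_hom_app`).

## References

* [Elzein1983] F. El Zein, Mixed Hodge structures, Trans. AMS 275 (1983), §II.0.1–II.0.2.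
* [Fujiki1980] A. Fujiki, Duality of mixed Hodge structures of algebraic varieties, Publ. RIMS 16 (1980), (1.6.2) a).
* [DeligneHodgeII1971] P. Deligne, Théorie de Hodge II, Publ. Math. IHÉS 40 (1971), 1.1.6–1.1.7, 1.1.11, Thm. 2.3.5 (iii).
* [CattaniElZeinGriffithsLe2014] E. Cattani et al. (eds.), Hodge Theory, Princeton Math. Notes 49 (2014), §3.2.2.7, Thm. 3.2.18.

## Provenance

Lane `lit-hodgefound` (summit `HodgeConjecture`), seat `lit-hodgefound-p36` (literature-prover, generation 48, row g48-#4).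
-/

noncomputable section

open CategoryTheory Opposite

namespace Literature.AlgebraicGeometry.Motives

universe u

namespace MixedHodgeStructureCat

variable [HodgeTensorFacts.{u, u}] (k : ℤ)

/-! ## §1 The isomorphism `Gr^W_k(X^∨) ⥲ (Gr^W_{-k} X)^∨`, `[φ] ↦ ([w] ↦ φ w)` -/

section Objects

variable (X : MixedHodgeStructureCat.{u}) [Module.Finite ℚ X]

/-- **`(Gr^W_{-k} X)^∨` as an object of `HodgeStructureCat k`**: the dual of the pure Hodge structure `Gr^W_{-k} X` (weight `-(-k)`, the tree's
`HodgeStructure.dual`) transported to weight `k`. [cite: Elzein1983, §II.0.2] [cite: DeligneHodgeII1971, 1.1.6–1.1.7] -/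
abbrev grDualObj : HodgeStructureCat.{u} k :=
  HodgeStructureCat.of (((X.str.gr (-k)).dual).cast (neg_neg k))

/-- **`Gr^W_k(X^∨) ⟶ (Gr^W_{-k} X)^∨`, `[φ] ↦ ([w] ↦ φ w)`** — a morphism of Hodge structures of weight `k` (the tree's `dualGrHom`:
`W_k(X^∨) = (W_{-k-1} X)^⊥`, so a form in `W_k(X^∨)` restricts to `W_{-k} X ∕ W_{-k-1} X`). [cite: Elzein1983, §II.0.2] [cite: Fujiki1980, (1.6.2) a)] -/
def grDualHom : (gr k).obj (of X.str.dual) ⟶ grDualObj k X := MixedHodgeStructure.dualGrHom X.str k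

/-- The underlying map of `grDualHom` is the tree's `dualGrMap`. [cite: Elzein1983, §II.0.2] -/
@[simp]
theorem grDualHom_toLinearMap : (grDualHom k X).toLinearMap = MixedHodgeStructure.dualGrMap X.str k := rfl

/-- `grDualHom [φ] [w] = φ w`. [cite: Elzein1983, §II.0.2] -/
theorem grDualHom_toLinearMap_mk_mk (φ : (of X.str.dual).str.W k) (w : X.str.W (-k)) :
    (grDualHom k X).toLinearMap (Submodule.Quotient.mk φ) (Submodule.Quotient.mk w) = (φ : Module.Dual ℚ X) w :=
  MixedHodgeStructure.dualGrMap_mk_mk X.str k φ w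

/-- **`Gr^W_k(X^∨) ⟶ (Gr^W_{-k} X)^∨` is bijective.** [cite: Elzein1983, §II.0.2] -/
theorem grDualHom_bijective : Function.Bijective (grDualHom k X).toLinearMap := MixedHodgeStructure.dualGrHom_bijective X.str k

/-- `grDualHom` is an isomorphism of `HodgeStructureCat k` (strictness). [cite: Elzein1983, §II.0.2] [cite: CattaniElZeinGriffithsLe2014, Thm. 3.2.18] -/
theorem isIso_grDualHom : IsIso (grDualHom k X) := HodgeStructureCat.isIso_of_bijective _ (grDualHom_bijective k X)

/-- **`Gr^W_k(X^∨) ≅ (Gr^W_{-k} X)^∨` in `HodgeStructureCat k`** (inverse by strictness, the tree's `HodgeStructure.Hom.inverse`).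
[cite: Elzein1983, §II.0.2] [cite: Fujiki1980, (1.6.2) a)] [cite: DeligneHodgeII1971, 1.1.11] -/
def grDualIso : (gr k).obj (of X.str.dual) ≅ grDualObj k X where
  hom := grDualHom k X
  inv := HodgeStructure.Hom.inverse (grDualHom k X) (grDualHom_bijective k X)
  hom_inv_id := HodgeStructure.Hom.inverse_comp _ _
  inv_hom_id := HodgeStructure.Hom.comp_inverse _ _

/-- Unfolding `grDualIso` (hom). [cite: Elzein1983, §II.0.2] -/
theorem grDualIso_hom : (grDualIso k X).hom = grDualHom k X := rfl

/-- `inv (hom u) = u`. [cite: Elzein1983, §II.0.2] -/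
@[simp]
theorem grDualIso_inv_toLinearMap_hom_toLinearMap (u : (gr k).obj (of X.str.dual)) :
    (grDualIso k X).inv.toLinearMap ((grDualIso k X).hom.toLinearMap u) = u :=
  HodgeStructure.Hom.inverse_apply_apply _ _ u

/-- `hom (inv ψ) = ψ`. [cite: Elzein1983, §II.0.2] -/
@[simp]
theorem grDualIso_hom_toLinearMap_inv_toLinearMap (ψ : grDualObj k X) :
    (grDualIso k X).hom.toLinearMap ((grDualIso k X).inv.toLinearMap ψ) = ψ :=
  HodgeStructure.Hom.apply_inverse_apply _ _ ψ

/-- `h^{p,q}` check: the two sides have the same Hodge numbers (the tree's `gr_dual_hodgeNumber`, restated on the objects of this file).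
[cite: Elzein1983, §II.0.2] -/
theorem hodgeNumber_gr_obj_dual (p q : ℤ) : ((gr k).obj (of X.str.dual)).str.hodgeNumber p q = (grDualObj k X).str.hodgeNumber p q :=
  (grDualHom k X).hodgeNumber_eq_of_bijective (grDualHom_bijective k X) p q

end Objects

/-! ## §2 Naturality: `Gr^W_k(f^∨) ≫ (≅) = (≅) ≫ (Gr^W_{-k} f)^∨` -/

section Naturality

variable {X Y Z : MixedHodgeStructureCat.{u}} [Module.Finite ℚ X] [Module.Finite ℚ Y] [Module.Finite ℚ Z]

/-- **`(Gr^W_{-k} f)^∨ : (Gr^W_{-k} Y)^∨ ⟶ (Gr^W_{-k} X)^∨`** for `f : X ⟶ Y`: the transpose of the morphism of pure Hodge structures `Gr^W_{-k} f`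
(the tree's `HodgeStructure.Hom.dualMap`), weight transported to `k`. [cite: DeligneHodgeII1971, 1.1.6–1.1.7 and Thm. 2.3.5 (iii)] -/
def grDualMapHom (f : X ⟶ Y) : grDualObj k Y ⟶ grDualObj k X where
  toLinearMap := (f.grMap (-k)).dualMap
  map_F_le p := (HodgeStructure.Hom.dualMap (f.gr (-k))).map_F_le p

/-- Underlying map of `(Gr^W_{-k} f)^∨`: the transpose of `Gr^W_{-k}(f)`. [cite: DeligneHodgeII1971, 1.1.6–1.1.7] -/
@[simp]
theorem grDualMapHom_toLinearMap (f : X ⟶ Y) : (grDualMapHom k f).toLinearMap = (f.grMap (-k)).dualMap := rfl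

variable (X) in
/-- `(Gr 𝟙)^∨ = 𝟙`. [cite: DeligneHodgeII1971, 1.1.6–1.1.7] -/
theorem grDualMapHom_id : grDualMapHom k (𝟙 X) = 𝟙 (grDualObj k X) := by
  refine HodgeStructureCat.hom_ext ?_
  rw [grDualMapHom_toLinearMap]
  change ((MixedHodgeStructure.Hom.id X.str).grMap (-k)).dualMap = LinearMap.id
  rw [MixedHodgeStructure.Hom.grMap_id, LinearMap.dualMap_id]

/-- `(Gr (f ≫ g))^∨ = (Gr g)^∨ ≫ (Gr f)^∨` (contravariance). [cite: DeligneHodgeII1971, 1.1.6–1.1.7] -/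
theorem grDualMapHom_comp (f : X ⟶ Y) (g : Y ⟶ Z) : grDualMapHom k (f ≫ g) = grDualMapHom k g ≫ grDualMapHom k f := by
  refine HodgeStructureCat.hom_ext ?_
  change ((MixedHodgeStructure.Hom.comp g f).grMap (-k)).dualMap = (f.grMap (-k)).dualMap ∘ₗ (g.grMap (-k)).dualMap
  rw [MixedHodgeStructure.Hom.grMap_comp, LinearMap.dualMap_comp_dualMap]

/-- **Naturality on classes**: `⟨(≅)(Gr_k(f^∨) [φ]), [w]⟩ = φ (f w) = ⟨(≅) [φ], Gr_{-k}(f) [w]⟩` for `φ ∈ W_k(Y^∨)`, `w ∈ W_{-k} X`.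
[cite: Elzein1983, §II.0.2] [cite: DeligneHodgeII1971, 1.1.6–1.1.7] -/
theorem grDualHom_grMap_transposeHom_mk_mk (f : X ⟶ Y) (φ : (of Y.str.dual).str.W k) (w : X.str.W (-k)) :
    (grDualHom k X).toLinearMap ((transposeHom f).grMap k (Submodule.Quotient.mk φ)) (Submodule.Quotient.mk w) =
      (grDualHom k Y).toLinearMap (Submodule.Quotient.mk φ) (f.grMap (-k) (Submodule.Quotient.mk w)) := by
  rw [MixedHodgeStructure.Hom.grMap_mk, MixedHodgeStructure.Hom.grMap_mk, grDualHom_toLinearMap_mk_mk, grDualHom_toLinearMap_mk_mk,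
    MixedHodgeStructure.Hom.coe_restrictW, MixedHodgeStructure.Hom.coe_restrictW, transposeHom_toLinearMap, LinearMap.dualMap_apply]

/-- **Naturality of `Gr^W_k(X^∨) ≅ (Gr^W_{-k} X)^∨`**: for `f : X ⟶ Y`, `Gr^W_k(f^∨) ≫ (≅)_X = (≅)_Y ≫ (Gr^W_{-k} f)^∨` («compatible with morphisms»).
[cite: Elzein1983, §II.0.2] [cite: DeligneHodgeII1971, 1.1.6–1.1.7 and Thm. 2.3.5 (iii)] -/
theorem gr_map_transposeHom_comp_grDualHom (f : X ⟶ Y) :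
    (gr k).map (transposeHom f) ≫ grDualHom k X = grDualHom k Y ≫ grDualMapHom k f := by
  refine HodgeStructureCat.hom_ext (LinearMap.ext fun u => LinearMap.ext fun v => ?_)
  induction u using Submodule.Quotient.induction_on with
  | _ φ =>
    induction v using Submodule.Quotient.induction_on with
    | _ w =>
      change (grDualHom k X).toLinearMap ((transposeHom f).grMap k (Submodule.Quotient.mk φ)) (Submodule.Quotient.mk w) =
        (f.grMap (-k)).dualMap ((grDualHom k Y).toLinearMap (Submodule.Quotient.mk φ)) (Submodule.Quotient.mk w)
      rw [LinearMap.dualMap_apply]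
      exact grDualHom_grMap_transposeHom_mk_mk k f φ w

/-- The same for the isomorphisms: `Gr^W_k(f^∨) ≫ (grDualIso X).hom = (grDualIso Y).hom ≫ (Gr^W_{-k} f)^∨`. [cite: Elzein1983, §II.0.2] -/
theorem gr_map_transposeHom_comp_grDualIso_hom (f : X ⟶ Y) :
    (gr k).map (transposeHom f) ≫ (grDualIso k X).hom = (grDualIso k Y).hom ≫ grDualMapHom k f :=
  gr_map_transposeHom_comp_grDualHom k f

/-- Conjugation form: `Gr^W_k(f^∨) = (≅)_Y ≫ (Gr^W_{-k} f)^∨ ≫ (≅)_X⁻¹`. [cite: Elzein1983, §II.0.2] -/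
theorem gr_map_transposeHom_eq_conj (f : X ⟶ Y) :
    (gr k).map (transposeHom f) = (grDualIso k Y).hom ≫ grDualMapHom k f ≫ (grDualIso k X).inv := by
  rw [← Category.assoc, ← gr_map_transposeHom_comp_grDualIso_hom, Category.assoc, Iso.hom_inv_id, Category.comp_id]

/-- Inverse form: `(grDualIso Y).inv ≫ Gr^W_k(f^∨) = (Gr^W_{-k} f)^∨ ≫ (grDualIso X).inv`. [cite: Elzein1983, §II.0.2] -/
theorem grDualIso_inv_comp_gr_map_transposeHom (f : X ⟶ Y) :
    (grDualIso k Y).inv ≫ (gr k).map (transposeHom f) = grDualMapHom k f ≫ (grDualIso k X).inv := by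
  rw [gr_map_transposeHom_eq_conj, Iso.inv_hom_id_assoc]

end Naturality

/-! ## §3 As a natural isomorphism of functors `FinSubcategoryᵒᵖ ⥤ HodgeStructureCat k` -/

section NatIso

/-- The functor **`X ↦ (Gr^W_{-k} X)^∨`, `f ↦ (Gr^W_{-k} f)^∨`** on finite-dimensional mixed Hodge structures (contravariant).
[cite: DeligneHodgeII1971, 1.1.6–1.1.7 and Thm. 2.3.5 (iii)] -/
def grDualFunctor : FinSubcategory.{u}ᵒᵖ ⥤ HodgeStructureCat.{u} k where
  obj X := haveI : Module.Finite ℚ X.unop.obj := X.unop.property; grDualObj k X.unop.obj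
  map {X Y} f :=
    haveI : Module.Finite ℚ X.unop.obj := X.unop.property
    haveI : Module.Finite ℚ Y.unop.obj := Y.unop.property
    grDualMapHom k f.unop.hom
  map_id X := by
    haveI : Module.Finite ℚ X.unop.obj := X.unop.property
    exact grDualMapHom_id k X.unop.obj
  map_comp {X Y Z} f g := by
    haveI : Module.Finite ℚ X.unop.obj := X.unop.property
    haveI : Module.Finite ℚ Y.unop.obj := Y.unop.property
    haveI : Module.Finite ℚ Z.unop.obj := Z.unop.property
    exact grDualMapHom_comp k g.unop.hom f.unop.hom

/-- Unfolding `grDualFunctor` on objects. [cite: DeligneHodgeII1971, 1.1.6–1.1.7] -/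
theorem grDualFunctor_obj (X : FinSubcategory.{u}ᵒᵖ) :
    (grDualFunctor k).obj X = (haveI : Module.Finite ℚ X.unop.obj := X.unop.property; grDualObj k X.unop.obj) := rfl

/-- Unfolding `grDualFunctor` on morphisms. [cite: DeligneHodgeII1971, 1.1.6–1.1.7] -/
theorem grDualFunctor_map_toLinearMap {X Y : FinSubcategory.{u}ᵒᵖ} (f : X ⟶ Y) :
    ((grDualFunctor k).map f).toLinearMap = (f.unop.hom.grMap (-k)).dualMap := rfl

/-- **`Gr^W_k ∘ (−)^∨ ≅ ((−)^∨) ∘ Gr^W_{-k}`**: `Gr^W_k` commutes with the duality functor of finite-dimensional mixed Hodge structures, as a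
natural isomorphism of functors `FinSubcategoryᵒᵖ ⥤ HodgeStructureCat k` (components `grDualIso`). [cite: Elzein1983, §II.0.2]
[cite: Fujiki1980, (1.6.2) a)] [cite: DeligneHodgeII1971, 1.1.6–1.1.7] -/
def grDualNatIso : dualFunctor.{u} ⋙ isFinite.ι ⋙ gr k ≅ grDualFunctor k :=
  NatIso.ofComponents
    (fun X => haveI : Module.Finite ℚ X.unop.obj := X.unop.property; grDualIso k X.unop.obj)
    (fun {X Y} f => by
      haveI : Module.Finite ℚ X.unop.obj := X.unop.property
      haveI : Module.Finite ℚ Y.unop.obj := Y.unop.property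
      exact gr_map_transposeHom_comp_grDualIso_hom k f.unop.hom)

/-- Components of `grDualNatIso`. [cite: Elzein1983, §II.0.2] -/
theorem grDualNatIso_hom_app (X : FinSubcategory.{u}ᵒᵖ) :
    (grDualNatIso k).hom.app X = (haveI : Module.Finite ℚ X.unop.obj := X.unop.property; (grDualIso k X.unop.obj).hom) := rfl

end NatIso

end MixedHodgeStructureCat

end Literature.AlgebraicGeometry.Motives

end
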